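import Literature.Algebra.Lie.SkewAdjointToMatrixTransport
import Literature.Algebra.Lie.OrthogonalAlgebraSimple
import HarnessLib

/-!
# Looijenga–Lunts (2.9), orthogonal cases, BASIS-FREE: a hyperbolic pair `e, f` in a non-degenerate quadratic space `(V, B)` grades `𝔰𝔬(V, B)` into a Jordan–Lefschetz pair

Topic `Literature/Algebra/Lie` (namespace `Literature.Algebra.Lie.HyperbolicPlaneGrading`).  Lane `lit-hodgefound`
(Track 2 foundations library), skeleton seat `lit-hodgefound-skel-1` (generation 51), row **A1-203** of
`run/shared/lean/pub/lit-hodgefound/SKELETON.md`.  Rows A1-195 (`typeD`, even) and A1-196 (`typeB`, odd) proved the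
isotropic-line gradings of (2.9) in Humphreys' split MATRIX coordinates, and row A1-198 transports them to
`skewAdjointLieSubalgebra B` GIVEN a basis with Gram matrix `JD` / `JB` adapted to the grading element.  This file
removes the basis from the statement, exactly as (2.9) is printed: over an algebraically closed field of characteristic
`0` ("We only do this over the complex numbers"), for ANY non-degenerate symmetric bilinear form `B` on `V` with
`dim V ≥ 3` and ANY hyperbolic pair `e, f ∈ V` (`B(e,e) = B(f,f) = 0`, `B(e,f) = 1` — "isotropic lines `V_{±2}` such
that `V_{-2} ⊕ V_2` is nondegenerate"), the element `h = h_{e,f} ∈ 𝔰𝔬(V, B)`, `h v = 2(B(v,f) e - B(v,e) f)` ("the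
element with the eigen space decomposition `V_{-2} ⊕ V_0 ⊕ V_2`": `h e = 2e`, `h f = -2f`, `h|_{V_0} = 0`,
`V_0 = {e,f}^⊥`) makes `(𝔰𝔬(V, B), h)` a Jordan–Lefschetz pair (`Literature.Algebra.Lie.IsJordanLefschetzPair`, row
A1-84).  The proof builds an adapted hyperbolic basis: `V_0` is non-degenerate of dimension `dim V - 2` and so has a
basis with Gram matrix `JD` (even) or `JB` (odd) by row A1-187 (`exists_basis_toMatrix_eq_JD/JB`, which is where
algebraic closedness enters); prepending `e, f` gives a basis of `V` with Gram matrix `JD (Unit ⊕ Fin k)` resp.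
`JB (Unit ⊕ Fin k)` in which `h = 2(E_{aa} - E_{a'a'})`, `a = inl ()`, and row A1-198 applies.  This is the form in
which (2.9) is used for `H^2` of a compact Kähler surface / the Mukai lattice (`V = U ⊕ V_0`, `U` a hyperbolic plane).
THEOREMS ONLY (no definition, no named fact, no `sorry`; net debt `0`).

## Source, VERBATIM

E. Looijenga, V. A. Lunts, *A Lie algebra attached to a projective variety*, Invent. Math. **129** (1997) 361–412 (held
TeX `paper:arxiv-alg-geom_9604014`), §2 p. 10 L79–L81: "Let us describe the fundamental Jordan–Lefschetz
representations in the classical cases … We only do this over the complex numbers."  (2.9) p. 10 L94–L103: "Case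
`(B_m, B_{m-1})` or `(D_m, D_{m-1})`: `(𝔰𝔬(n), 𝔰𝔬(n-2))` with `m = 2n+1` resp. `m = 2n` (`n ≥ 2`).  Let `V` be a
vector space of dimension `n` equipped with a nondegenerate symmetric bilinear form and let `V_{±2}` be isotropic lines
in `V` such that `V_{-2} ⊕ V_2` is nondegenerate.  Let `V_0` be the orthogonal complement of `V_{-2} ⊕ V_2` in `V`.
We take `𝔤 = 𝔰𝔬(V)` and let `h ∈ 𝔰𝔬(V)` be the element with the eigen space decomposition `V_{-2} ⊕ V_0 ⊕ V_2`.
Then `𝔤_0 = 𝔰𝔬(V_0) × 𝔤𝔩(V_2)` and `𝔤_{±2}` projects isomorphically to `Hom(V_0, V_{±2})`."  (2.6) p. 10 L16–L31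
(the list, "`(B_l, α_l)`, … `(D_l, ϖ_1)`").

## Contents (all proved)

* §1 `hyperbolicGrading_apply`, `hyperbolicGrading_mem_skewAdjointLieSubalgebra` (`h_{e,f} ∈ 𝔰𝔬(V, B)`),
  `hyperbolicGrading_apply_eq` (`h e = 2e`, `h f = -2f`, `h|_{V_0} = 0`);
* §2 `linearIndependent_pair`, `restrict_span_pair_nondegenerate` (the plane `Ke ⊕ Kf` is non-degenerate),
  `finrank_span_pair`;
* §3 **`isJordanLefschetzPair_hyperbolicGrading_of_even`** (`dim V = 2n`, `n ≥ 2`: type `(D_n, D_{n-1})`);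
* §4 **`isJordanLefschetzPair_hyperbolicGrading_of_odd`** (`dim V = 2n+1`, `n ≥ 1`: type `(B_n, B_{n-1})`);
* §5 **`isJordanLefschetzPair_hyperbolicGrading`** (`dim V ≥ 3`), `isJordanLefschetzPair_hyperbolicGrading_mk`,
  `isLefschetzPair_hyperbolicGrading`.
-/

namespace Literature.Algebra.Lie.HyperbolicPlaneGrading

open Module LieAlgebra LieAlgebra.Orthogonal Matrix Sum Literature.Algebra.Lie

variable {K : Type*} [Field K] {V : Type*} [AddCommGroup V] [Module K V] {B : LinearMap.BilinForm K V}

/-! ### §1 The grading endomorphism `h_{e,f} : v ↦ 2(B(v, f) e - B(v, e) f)` of a hyperbolic pair is skew-adjoint -/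

/-- The values of `h_{e,f}`. [cite: LooijengaLunts1997, §2 (2.9) p. 10 L94–L103] -/
theorem hyperbolicGrading_apply (e f v : V) :
    ((2 : K) • ((B.flip f).smulRight e - (B.flip e).smulRight f) : Module.End K V) v =
      (2 : K) • (B v f • e - B v e • f) := by
  simp only [LinearMap.smul_apply, LinearMap.sub_apply, LinearMap.smulRight_apply, LinearMap.BilinForm.flip_apply]

/-- `h_{e,f} ∈ 𝔰𝔬(V, B)` for `B` symmetric: `B(h v, w) + B(v, h w) = 0`. [cite: LooijengaLunts1997, §2 (2.9) p. 10 L94–L103 ("h ∈ 𝔰𝔬(V) … the element with the eigen space decomposition V_{-2} ⊕ V_0 ⊕ V_2")] -/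
theorem hyperbolicGrading_mem_skewAdjointLieSubalgebra (hs : ∀ u v : V, B u v = B v u) (e f : V) :
    ((2 : K) • ((B.flip f).smulRight e - (B.flip e).smulRight f) : Module.End K V) ∈ skewAdjointLieSubalgebra B := by
  show ((2 : K) • ((B.flip f).smulRight e - (B.flip e).smulRight f) : Module.End K V) ∈ B.skewAdjointSubmodule
  rw [LinearMap.mem_skewAdjointSubmodule]
  intro v w
  rw [Pi.neg_apply, hyperbolicGrading_apply, hyperbolicGrading_apply, LinearMap.BilinForm.neg_right,
    LinearMap.BilinForm.smul_left, LinearMap.BilinForm.sub_left, LinearMap.BilinForm.smul_left,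
    LinearMap.BilinForm.smul_left, LinearMap.BilinForm.smul_right, LinearMap.BilinForm.sub_right,
    LinearMap.BilinForm.smul_right, LinearMap.BilinForm.smul_right, hs e w, hs f w]
  ring

/-- The eigenvalues of `h_{e,f}` on `V`: `h e = 2e`, `h f = -2f`, `h w = 0` for `w ⊥ e, f` ("the eigen space
decomposition `V_{-2} ⊕ V_0 ⊕ V_2`"). [cite: LooijengaLunts1997, §2 (2.9) p. 10 L94–L103] -/
theorem hyperbolicGrading_apply_eq (hs : ∀ u v : V, B u v = B v u) {e f : V} (he : B e e = 0) (hf : B f f = 0)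
    (hef : B e f = 1) :
    ((2 : K) • ((B.flip f).smulRight e - (B.flip e).smulRight f) : Module.End K V) e = (2 : K) • e ∧
      ((2 : K) • ((B.flip f).smulRight e - (B.flip e).smulRight f) : Module.End K V) f = -((2 : K) • f) ∧
      ∀ w : V, B w e = 0 → B w f = 0 →
        ((2 : K) • ((B.flip f).smulRight e - (B.flip e).smulRight f) : Module.End K V) w = 0 := by
  refine ⟨?_, ?_, fun w hwe hwf ↦ ?_⟩
  · rw [hyperbolicGrading_apply, hef, he, one_smul, zero_smul, sub_zero]
  · rw [hyperbolicGrading_apply, hf, hs f e, hef, zero_smul, one_smul, zero_sub, smul_neg]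
  · rw [hyperbolicGrading_apply, hwe, hwf, zero_smul, zero_smul, sub_zero, smul_zero]

/-! ### §2 The hyperbolic plane `P = Ke ⊕ Kf` and its orthogonal complement -/

section Plane

variable (hs : ∀ u v : V, B u v = B v u) {e f : V} (he : B e e = 0) (hf : B f f = 0) (hef : B e f = 1)
include hs he hf hef

/-- `e, f` are linearly independent. [cite: LooijengaLunts1997, §2 (2.9) p. 10 L96–L98 ("V_{±2} be isotropic lines in V such that V_{-2} ⊕ V_2 is nondegenerate")] -/
theorem linearIndependent_pair : LinearIndependent K ![e, f] := by
  rw [LinearIndependent.pair_iff]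
  intro s t hst
  have h1 := congrArg (fun w ↦ B w e) hst
  have h2 := congrArg (fun w ↦ B w f) hst
  simp only [LinearMap.BilinForm.add_left, LinearMap.BilinForm.smul_left, he, hef, hs f e, hf,
    LinearMap.BilinForm.zero_left, mul_zero, mul_one, zero_add, add_zero] at h1 h2
  exact ⟨h2, h1⟩

/-- The plane `P = span {e, f}` is non-degenerate. [cite: LooijengaLunts1997, §2 (2.9) p. 10 L96–L98] -/
theorem restrict_span_pair_nondegenerate :
    (B.restrict (Submodule.span K (Set.range ![e, f]))).Nondegenerate := by
  have hsym : (B.restrict (Submodule.span K (Set.range ![e, f]))).IsSymm :=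
    (LinearMap.BilinForm.isSymm_def.2 hs).restrict _
  rw [LinearMap.BilinForm.Nondegenerate, hsym.isRefl.nondegenerate_iff_separatingLeft]
  intro x hx
  obtain ⟨x, hxP⟩ := x
  obtain ⟨c, rfl⟩ := (Submodule.mem_span_range_iff_exists_fun K).1 hxP
  have h1 := hx ⟨e, Submodule.subset_span ⟨0, rfl⟩⟩
  have h2 := hx ⟨f, Submodule.subset_span ⟨1, rfl⟩⟩
  simp only [LinearMap.BilinForm.restrict_apply, LinearMap.domRestrict_apply, Fin.sum_univ_two, Matrix.cons_val_zero,
    Matrix.cons_val_one, LinearMap.BilinForm.add_left, LinearMap.BilinForm.smul_left, he, hef, hs f e, hf, mul_zero,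
    mul_one, zero_add, add_zero] at h1 h2
  apply Subtype.ext
  simp [Fin.sum_univ_two, h1, h2]

/-- `dim P = 2`. [cite: LooijengaLunts1997, §2 (2.9) p. 10 L96–L98] -/
theorem finrank_span_pair : finrank K (Submodule.span K (Set.range ![e, f])) = 2 := by
  rw [finrank_span_eq_card (linearIndependent_pair hs he hf hef), Fintype.card_fin]

end Plane

/-! ### §3 `(𝔰𝔬(V, B), h_{e,f})` is a Jordan–Lefschetz pair: `dim V` even (type `(D_n, D_{n-1})`) -/

section Even

variable [CharZero K] [IsAlgClosed K] [FiniteDimensional K V]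

/-- **(2.9), Case `(D_m, D_{m-1})`, AS PRINTED (basis-free, over an algebraically closed field of characteristic `0`)**:
let `V` carry a non-degenerate symmetric bilinear form `B`, `dim V = 2n ≥ 4`, and let `e, f` span a hyperbolic plane
(`B(e,e) = B(f,f) = 0`, `B(e,f) = 1`; `V_2 = Ke`, `V_{-2} = Kf` "isotropic lines … such that `V_{-2} ⊕ V_2` is
nondegenerate").  Then the element `h ∈ 𝔰𝔬(V, B)` "with the eigen space decomposition `V_{-2} ⊕ V_0 ⊕ V_2`" —
`h v = 2(B(v,f) e - B(v,e) f)` — makes `(𝔰𝔬(V, B), h)` a Jordan–Lefschetz pair.  Proof: `V_0 = {e,f}^⊥` is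
non-degenerate of dimension `2n - 2`, so has a hyperbolic basis (row A1-187 `exists_basis_toMatrix_eq_JD`); together with
`e, f` this is a hyperbolic basis of `V` in which `h = 2(E_{aa} - E_{a'a'})`, and row A1-198 transports row A1-195.
[cite: LooijengaLunts1997, §2 (2.9) p. 10 L94–L103, (2.6) p. 10 L16–L31; §2 p. 10 L79–L81 ("We only do this over the complex numbers")] -/
theorem isJordanLefschetzPair_hyperbolicGrading_of_even (hB : B.Nondegenerate) (hs : ∀ u v : V, B u v = B v u)
    {n : ℕ} (hn : finrank K V = n + n) (h2n : 2 ≤ n) {e f : V} (he : B e e = 0) (hf : B f f = 0) (hef : B e f = 1)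
    (x : skewAdjointLieSubalgebra B)
    (hx : (x : Module.End K V) = (2 : K) • ((B.flip f).smulRight e - (B.flip e).smulRight f)) :
    IsJordanLefschetzPair K x := by
  haveI : NeZero (2 : K) := ⟨two_ne_zero⟩
  have hsymm : B.IsSymm := LinearMap.BilinForm.isSymm_def.2 hs
  have hrefl : B.IsRefl := hsymm.isRefl
  -- the plane and its orthogonal complement
  set P : Submodule K V := Submodule.span K (Set.range ![e, f]) with hP
  set W : Submodule K V := B.orthogonal P with hWdef
  have heP : e ∈ P := Submodule.subset_span ⟨0, rfl⟩
  have hfP : f ∈ P := Submodule.subset_span ⟨1, rfl⟩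
  have hWe : ∀ w : W, B e w = 0 := fun w ↦ (LinearMap.BilinForm.mem_orthogonal_iff.1 w.2) e heP
  have hWf : ∀ w : W, B f w = 0 := fun w ↦ (LinearMap.BilinForm.mem_orthogonal_iff.1 w.2) f hfP
  have hPW : IsCompl P W :=
    LinearMap.BilinForm.isCompl_orthogonal_of_restrict_nondegenerate hrefl
      (restrict_span_pair_nondegenerate hs he hf hef)
  have hWnd : (B.restrict W).Nondegenerate := by
    rw [LinearMap.BilinForm.restrict_nondegenerate_iff_isCompl_orthogonal hrefl, hWdef,
      LinearMap.BilinForm.orthogonal_orthogonal hB hrefl]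
    exact hPW.symm
  have hWs : ∀ u v : W, (B.restrict W) u v = (B.restrict W) v u := fun u v ↦ by
    rw [LinearMap.BilinForm.restrict_apply, LinearMap.BilinForm.restrict_apply]; exact hs u v
  have hfinW : finrank K W = (n - 1) + (n - 1) := by
    rw [hWdef, LinearMap.BilinForm.finrank_orthogonal hB, hn, hP, finrank_span_pair hs he hf hef]
    omega
  -- a hyperbolic basis of `W`
  obtain ⟨c, hc⟩ := OrthogonalAlgebraSimple.exists_basis_toMatrix_eq_JD hWnd hWs hfinW
  have hcc : ∀ i j, B (c i : V) (c j) = JD (Fin (n - 1)) K i j := fun i j ↦ by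
    rw [← hc, LinearMap.BilinForm.toMatrix_apply]; rfl
  -- the adapted basis of `V`
  let v : (Unit ⊕ Fin (n - 1)) ⊕ (Unit ⊕ Fin (n - 1)) → V :=
    Sum.elim (Sum.elim (fun _ ↦ e) (fun i ↦ (c (inl i) : V))) (Sum.elim (fun _ ↦ f) (fun i ↦ (c (inr i) : V)))
  have hG : ∀ p q, B (v p) (v q) = JD (Unit ⊕ Fin (n - 1)) K p q := by
    rintro ((_ | i) | (_ | i)) ((_ | j) | (_ | j))
    all_goals simp only [v, Sum.elim_inl, Sum.elim_inr, JD, fromBlocks_apply₁₁, fromBlocks_apply₁₂,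
      fromBlocks_apply₂₁, fromBlocks_apply₂₂, Matrix.zero_apply, Matrix.one_apply, he, hf, hef, hs f e, hWe, hWf,
      hs (c _ : V) e, hs (c _ : V) f, hcc, Sum.inr.injEq, reduceCtorEq, if_true, if_false]
  have hdual : ∀ p q, B (v p) (v (Sum.swap q)) = if p = q then 1 else 0 := by
    intro p q
    rw [hG]
    rcases p with (_ | i) | (_ | i) <;> rcases q with (_ | j) | (_ | j) <;>
      simp [JD, Matrix.one_apply, eq_comm]
  have hli : LinearIndependent K v := by
    rw [Fintype.linearIndependent_iff]
    intro g hg q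
    have h1 := congrArg (fun w ↦ B w (v (Sum.swap q))) hg
    simp only [LinearMap.BilinForm.sum_left, LinearMap.BilinForm.smul_left, hdual, mul_ite, mul_one, mul_zero,
      Finset.sum_ite_eq', Finset.mem_univ, if_true, LinearMap.BilinForm.zero_left] at h1
    exact h1
  have hcard : Fintype.card ((Unit ⊕ Fin (n - 1)) ⊕ (Unit ⊕ Fin (n - 1))) = finrank K V := by
    simp only [Fintype.card_sum, Fintype.card_unit, Fintype.card_fin, hn]; omega
  have hspan : ⊤ ≤ Submodule.span K (Set.range v) := (hli.span_eq_top_of_card_eq_finrank' hcard).ge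
  let b : Basis ((Unit ⊕ Fin (n - 1)) ⊕ (Unit ⊕ Fin (n - 1))) K V := Basis.mk hli hspan
  have hb : ∀ p, b p = v p := fun p ↦ Basis.mk_apply hli hspan p
  -- its Gram matrix is `JD`
  have hGram : LinearMap.BilinForm.toMatrix b B = JD (Unit ⊕ Fin (n - 1)) K := by
    ext p q; rw [LinearMap.BilinForm.toMatrix_apply, hb, hb, hG]
  -- the matrix of `h` is `2(E_{aa} - E_{a'a'})`, `a = inl ()`
  have hBf : ∀ q, B (v q) f = if q = inl (inl ()) then 1 else 0 := fun q ↦ by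
    have := hdual q (inl (inl ())); simpa [v] using this
  have hBe : ∀ q, B (v q) e = if q = inr (inl ()) then 1 else 0 := fun q ↦ by
    have := hdual q (inr (inl ())); simpa [v] using this
  have hre : b.repr e = Finsupp.single (inl (inl ())) 1 := by
    conv_lhs => rw [show e = b (inl (inl ())) from (hb (inl (inl ()))).symm]
    exact b.repr_self _
  have hrf : b.repr f = Finsupp.single (inr (inl ())) 1 := by
    conv_lhs => rw [show f = b (inr (inl ())) from (hb (inr (inl ()))).symm]
    exact b.repr_self _
  have hxmat : LinearMap.toMatrix b b (x : Module.End K V) =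
      (2 : K) • (single (inl (inl ())) (inl (inl ())) (1 : K) - single (inr (inl ())) (inr (inl ())) 1) := by
    ext p q
    rw [LinearMap.toMatrix_apply, hb, hx, hyperbolicGrading_apply, hBf, hBe]
    simp only [map_smul, map_sub, hre, hrf, Finsupp.smul_apply, Finsupp.sub_apply, Finsupp.single_apply,
      Matrix.smul_apply, Matrix.sub_apply, Matrix.single_apply, smul_eq_mul]
    rcases p with (_ | i) | (_ | i) <;> rcases q with (_ | j) | (_ | j) <;> simp
  have hm : 2 ≤ Fintype.card (Unit ⊕ Fin (n - 1)) := by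
    simp only [Fintype.card_sum, Fintype.card_unit, Fintype.card_fin]; omega
  exact SkewAdjointToMatrixTransport.isJordanLefschetzPair_skewAdjoint_of_toMatrix_eq_JD_hsub b B hGram hm (inl ()) x
    hxmat

end Even

/-! ### §4 `(𝔰𝔬(V, B), h_{e,f})` is a Jordan–Lefschetz pair: `dim V` odd (type `(B_n, B_{n-1})`) -/

section Odd

variable [CharZero K] [IsAlgClosed K] [FiniteDimensional K V]

/-- **(2.9), Case `(B_m, B_{m-1})`, AS PRINTED (basis-free, over an algebraically closed field of characteristic `0`)**:
`B` non-degenerate symmetric on `V` of ODD dimension `2n + 1 ≥ 3`, `e, f` a hyperbolic pair; then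
`h v = 2(B(v,f) e - B(v,e) f)` makes `(𝔰𝔬(V, B), h)` a Jordan–Lefschetz pair (`V_0 = {e,f}^⊥` has a basis with Gram
matrix `JB`, row A1-187 `exists_basis_toMatrix_eq_JB`; row A1-198 transports row A1-196).
[cite: LooijengaLunts1997, §2 (2.9) p. 10 L94–L103, (2.6) p. 10 L16–L31; §2 p. 10 L79–L81] -/
theorem isJordanLefschetzPair_hyperbolicGrading_of_odd (hB : B.Nondegenerate) (hs : ∀ u v : V, B u v = B v u)
    {n : ℕ} (hn : finrank K V = n + n + 1) (h1n : 1 ≤ n) {e f : V} (he : B e e = 0) (hf : B f f = 0) (hef : B e f = 1)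
    (x : skewAdjointLieSubalgebra B)
    (hx : (x : Module.End K V) = (2 : K) • ((B.flip f).smulRight e - (B.flip e).smulRight f)) :
    IsJordanLefschetzPair K x := by
  haveI : NeZero (2 : K) := ⟨two_ne_zero⟩
  have hsymm : B.IsSymm := LinearMap.BilinForm.isSymm_def.2 hs
  have hrefl : B.IsRefl := hsymm.isRefl
  -- the plane and its orthogonal complement
  set P : Submodule K V := Submodule.span K (Set.range ![e, f]) with hP
  set W : Submodule K V := B.orthogonal P with hWdef
  have heP : e ∈ P := Submodule.subset_span ⟨0, rfl⟩
  have hfP : f ∈ P := Submodule.subset_span ⟨1, rfl⟩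
  have hWe : ∀ w : W, B e w = 0 := fun w ↦ (LinearMap.BilinForm.mem_orthogonal_iff.1 w.2) e heP
  have hWf : ∀ w : W, B f w = 0 := fun w ↦ (LinearMap.BilinForm.mem_orthogonal_iff.1 w.2) f hfP
  have hPW : IsCompl P W :=
    LinearMap.BilinForm.isCompl_orthogonal_of_restrict_nondegenerate hrefl
      (restrict_span_pair_nondegenerate hs he hf hef)
  have hWnd : (B.restrict W).Nondegenerate := by
    rw [LinearMap.BilinForm.restrict_nondegenerate_iff_isCompl_orthogonal hrefl, hWdef,
      LinearMap.BilinForm.orthogonal_orthogonal hB hrefl]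
    exact hPW.symm
  have hWs : ∀ u v : W, (B.restrict W) u v = (B.restrict W) v u := fun u v ↦ by
    rw [LinearMap.BilinForm.restrict_apply, LinearMap.BilinForm.restrict_apply]; exact hs u v
  have hfinW : finrank K W = (n - 1) + (n - 1) + 1 := by
    rw [hWdef, LinearMap.BilinForm.finrank_orthogonal hB, hn, hP, finrank_span_pair hs he hf hef]
    omega
  -- a `JB`-basis of `W`
  obtain ⟨c, hc⟩ := OrthogonalAlgebraSimple.exists_basis_toMatrix_eq_JB hWnd hWs hfinW
  have hcc : ∀ i j, B (c i : V) (c j) = JB (Fin (n - 1)) K i j := fun i j ↦ by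
    rw [← hc, LinearMap.BilinForm.toMatrix_apply]; rfl
  -- the adapted basis of `V`
  let v : Unit ⊕ ((Unit ⊕ Fin (n - 1)) ⊕ (Unit ⊕ Fin (n - 1))) → V :=
    Sum.elim (fun _ ↦ (c (inl ()) : V))
      (Sum.elim (Sum.elim (fun _ ↦ e) (fun i ↦ (c (inr (inl i)) : V)))
        (Sum.elim (fun _ ↦ f) (fun i ↦ (c (inr (inr i)) : V))))
  have hG : ∀ p q, B (v p) (v q) = JB (Unit ⊕ Fin (n - 1)) K p q := by
    rintro (_ | ((_ | i) | (_ | i))) (_ | ((_ | j) | (_ | j)))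
    all_goals simp only [v, Sum.elim_inl, Sum.elim_inr, JB, JD, fromBlocks_apply₁₁, fromBlocks_apply₁₂,
      fromBlocks_apply₂₁, fromBlocks_apply₂₂, Matrix.zero_apply, Matrix.one_apply, Matrix.smul_apply, he, hf, hef,
      hs f e, hWe, hWf, hs (c _ : V) e, hs (c _ : V) f, hcc, Sum.inr.injEq, reduceCtorEq, if_true, if_false,
      smul_eq_mul, mul_one]
  -- the dual vectors: `c₀` pairs with itself to `2`, the others hyperbolically
  have hdual₀ : ∀ p, B (v p) (v (inl ())) = if p = inl () then 2 else 0 := by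
    intro p
    rw [hG]
    rcases p with _ | ((_ | i) | (_ | i)) <;> simp [JB, JD]
  have hdual : ∀ p r, B (v p) (v (inr (Sum.swap r))) = if p = inr r then 1 else 0 := by
    intro p r
    rw [hG]
    rcases p with _ | ((_ | i) | (_ | i)) <;> rcases r with (_ | j) | (_ | j) <;>
      simp [JB, JD, Matrix.one_apply, eq_comm]
  have hli : LinearIndependent K v := by
    rw [Fintype.linearIndependent_iff]
    intro g hg q
    rcases q with _ | r
    · have h1 := congrArg (fun w ↦ B w (v (inl ()))) hg
      simp only [LinearMap.BilinForm.sum_left, LinearMap.BilinForm.smul_left, hdual₀, mul_ite, mul_zero,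
        Finset.sum_ite_eq', Finset.mem_univ, if_true, LinearMap.BilinForm.zero_left, mul_eq_zero,
        two_ne_zero, or_false] at h1
      exact h1
    · have h1 := congrArg (fun w ↦ B w (v (inr (Sum.swap r)))) hg
      simp only [LinearMap.BilinForm.sum_left, LinearMap.BilinForm.smul_left, hdual, mul_ite, mul_one, mul_zero,
        Finset.sum_ite_eq', Finset.mem_univ, if_true, LinearMap.BilinForm.zero_left] at h1
      exact h1
  have hcard : Fintype.card (Unit ⊕ ((Unit ⊕ Fin (n - 1)) ⊕ (Unit ⊕ Fin (n - 1)))) = finrank K V := by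
    simp only [Fintype.card_sum, Fintype.card_unit, Fintype.card_fin, hn]; omega
  have hspan : ⊤ ≤ Submodule.span K (Set.range v) := (hli.span_eq_top_of_card_eq_finrank' hcard).ge
  let b : Basis (Unit ⊕ ((Unit ⊕ Fin (n - 1)) ⊕ (Unit ⊕ Fin (n - 1)))) K V := Basis.mk hli hspan
  have hb : ∀ p, b p = v p := fun p ↦ Basis.mk_apply hli hspan p
  -- its Gram matrix is `JB`
  have hGram : LinearMap.BilinForm.toMatrix b B = JB (Unit ⊕ Fin (n - 1)) K := by
    ext p q; rw [LinearMap.BilinForm.toMatrix_apply, hb, hb, hG]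
  -- the matrix of `h` is `2(E_{aa} - E_{a'a'})`, `a = inl ()` of the `D`-block
  have hBf : ∀ q, B (v q) f = if q = inr (inl (inl ())) then 1 else 0 := fun q ↦ by
    have := hdual q (inl (inl ())); simpa [v] using this
  have hBe : ∀ q, B (v q) e = if q = inr (inr (inl ())) then 1 else 0 := fun q ↦ by
    have := hdual q (inr (inl ())); simpa [v] using this
  have hre : b.repr e = Finsupp.single (inr (inl (inl ()))) 1 := by
    conv_lhs => rw [show e = b (inr (inl (inl ()))) from (hb (inr (inl (inl ())))).symm]
    exact b.repr_self _
  have hrf : b.repr f = Finsupp.single (inr (inr (inl ()))) 1 := by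
    conv_lhs => rw [show f = b (inr (inr (inl ()))) from (hb (inr (inr (inl ())))).symm]
    exact b.repr_self _
  have hxmat : LinearMap.toMatrix b b (x : Module.End K V) =
      (2 : K) • (single (inr (inl (inl ()))) (inr (inl (inl ()))) (1 : K) -
        single (inr (inr (inl ()))) (inr (inr (inl ()))) 1) := by
    ext p q
    rw [LinearMap.toMatrix_apply, hb, hx, hyperbolicGrading_apply, hBf, hBe]
    simp only [map_smul, map_sub, hre, hrf, Finsupp.smul_apply, Finsupp.sub_apply, Finsupp.single_apply,
      Matrix.smul_apply, Matrix.sub_apply, Matrix.single_apply, smul_eq_mul]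
    rcases p with _ | ((_ | i) | (_ | i)) <;> rcases q with _ | ((_ | j) | (_ | j)) <;> simp
  exact SkewAdjointToMatrixTransport.isJordanLefschetzPair_skewAdjoint_of_toMatrix_eq_JB_hsub b B hGram (inl ()) x hxmat

end Odd

/-! ### §5 Both parities together; the element `h_{e,f}` packaged -/

section All

variable [CharZero K] [IsAlgClosed K] [FiniteDimensional K V]

/-- **(2.9), types `B` and `D` together**: `B` non-degenerate symmetric, `dim V ≥ 3`, `e, f` a hyperbolic pair; then
`(𝔰𝔬(V, B), h_{e,f})` is a Jordan–Lefschetz pair. [cite: LooijengaLunts1997, §2 (2.9) p. 10 L94–L103, (2.6) p. 10 L16–L31 ("(B_l, α_l) … (D_l, ϖ_1)")] -/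
theorem isJordanLefschetzPair_hyperbolicGrading (hB : B.Nondegenerate) (hs : ∀ u v : V, B u v = B v u)
    (h3 : 3 ≤ finrank K V) {e f : V} (he : B e e = 0) (hf : B f f = 0) (hef : B e f = 1)
    (x : skewAdjointLieSubalgebra B)
    (hx : (x : Module.End K V) = (2 : K) • ((B.flip f).smulRight e - (B.flip e).smulRight f)) :
    IsJordanLefschetzPair K x := by
  obtain ⟨n, hn⟩ | ⟨n, hn⟩ := Nat.even_or_odd (finrank K V)
  · exact isJordanLefschetzPair_hyperbolicGrading_of_even hB hs hn (by omega) he hf hef x hx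
  · exact isJordanLefschetzPair_hyperbolicGrading_of_odd hB hs (n := n) (by omega) (by omega) he hf hef x hx

/-- The same with `h_{e,f}` as an explicit element of `𝔰𝔬(V, B)`. [cite: LooijengaLunts1997, §2 (2.9) p. 10 L94–L103] -/
theorem isJordanLefschetzPair_hyperbolicGrading_mk (hB : B.Nondegenerate) (hs : ∀ u v : V, B u v = B v u)
    (h3 : 3 ≤ finrank K V) {e f : V} (he : B e e = 0) (hf : B f f = 0) (hef : B e f = 1) :
    IsJordanLefschetzPair K (⟨(2 : K) • ((B.flip f).smulRight e - (B.flip e).smulRight f),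
      hyperbolicGrading_mem_skewAdjointLieSubalgebra hs e f⟩ : skewAdjointLieSubalgebra B) :=
  isJordanLefschetzPair_hyperbolicGrading hB hs h3 he hf hef _ rfl

/-- In particular `(𝔰𝔬(V, B), h_{e,f})` is a Lefschetz pair. [cite: LooijengaLunts1997, §2 (2.5) p. 9 L158–L163, (2.6) p. 10 L16–L31] -/
theorem isLefschetzPair_hyperbolicGrading (hB : B.Nondegenerate) (hs : ∀ u v : V, B u v = B v u)
    (h3 : 3 ≤ finrank K V) {e f : V} (he : B e e = 0) (hf : B f f = 0) (hef : B e f = 1)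
    (x : skewAdjointLieSubalgebra B)
    (hx : (x : Module.End K V) = (2 : K) • ((B.flip f).smulRight e - (B.flip e).smulRight f)) :
    IsLefschetzPair K x :=
  (isJordanLefschetzPair_hyperbolicGrading hB hs h3 he hf hef x hx).isLefschetzPair

end All

end Literature.Algebra.Lie.HyperbolicPlaneGrading
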